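import Summits.NavierStokesRegularity.NavierStokesRegularity.Theorems.ScenarioCensusRowF1InviscidTransfer
import HarnessLib

/-!
# LINE «inviscid-top» port, part 5/5: rows, Liouville rows, floor `ViscousTop`, residual `LaplacianDefectSlack` (≡ `Row_F1`); the rows are EXCLUDED
# (`rowF1vfq_holds`, …), displays, `laplacianDefectSlack_iff_rowF1` (§6); census KEYS `Row_F1vfq` / `Row_F1vgq` / `Row_F1afq` / `Row_F1vf` / `Row_F1vg` / `Row_F1af` + `_excluded`

Re-homed for the scenario census (typer seat ns-census-typer-1 g8; the cells F1vfq ⊇ F1afq, F1vgq and the o-forms F1vf / F1vg / F1af are MEMBERS OF RECORD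
«DECIDED IN KERNEL IN FILES» of row F1 since census v1.71 (critic idea-crit-3 PASS 21:40:30Z; ref ns-census-ref g8 PRE-CHECK ✓ §13.14 item 17; lead-presearch
label); this port makes them TREE-decided): VERBATIM PORT of ns-idea-3 LINE 18 «inviscid-top», `pub/ideators/ns-idea-3/lines/inviscid-top/line-inviscid-top.lean`
sha16 75cdf592fc13b830 (1259 l., lean check rc 0, 0 sorry), split for the 400-line rule into `ScenarioCensusRowF1Inviscid` (§1–§2) → `…InviscidZoom` (§3) →
`…InviscidLiouville` (§4) → `…InviscidTransfer` (§5) → `…InviscidTop` (§6 + census KEYS).  Lean text VERBATIM in namespace `…Theorems.ScenarioCensus.InviscidTop`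
(the line's `…Cruxes.ScenarioCensusRowF1.InviscidTopLine` re-homed); port edits: `@[conjecture]` on the residual `LaplacianDefectSlack` (≡ `ScenarioCensus.Row_F1`,
OPEN), fifteen one-line docstrings added (gate lint).

No census VALUE is moved here (row F1 stays OPEN-WITH-LINE; the members become TREE-decided by name); NS regularity is NOT proved; `Row_F1` is
untouched (zero movement, `laplacianDefectSlack_iff_rowF1`); no summit statement is proved by this file. Lemmas that restate already-landed tree declarations are taken BY NAME (gate lint `dedup.landed`): `tendsto_physicalTime` = `ColumnarTop.tendsto_physicalTime`, `eventually_fast` = `ColumnarTop.eventually_fast`, `sqrt_timeLag` = `StretchedTop.sqrt_timeLag`, `forall_of_forall_ne_zero` = `StretchedTop.forall_of_forall_ne_zero`.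
-/

-- the summit and its single problem share the name `NavierStokesRegularity` (D-0017 nested layout)
set_option linter.dupNamespace false

noncomputable section

open MeasureTheory Set Function Filter TopologicalSpace Metric
open scoped Topology NNReal ENNReal InnerProductSpace RealInnerProductSpace Laplacian

namespace Summit.NavierStokesRegularity.NavierStokesRegularity.Theorems.ScenarioCensus.InviscidTop

open Literature.Analysis Literature.Analysis.FluidPDE
open Summit.NavierStokesRegularity.NavierStokesRegularity.Theorems

/-! ## §6 Rows, Liouville rows, floor, residual; the rows are EXCLUDED; displays; residual ≡ `Row_F1` -/

/-- **Criterion row F1vfq** (`M`-quantitative form: Type I(`M`) + ε(M)-INVISCID TOP ⇒ extension): for every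
`M` ONE `ε > 0` such that the frame of `Row_F1` + `IsTypeIBlowupWith M ν u T` + a subcritical level with
`√ν (T − t)^{3/2} ‖Δu‖ ≤ ε` on its top ⇒ `HasSmoothExtensionPast`.  PROVED (`rowF1vfq_holds`). -/
def Row_F1vfq : Prop :=
  ∀ M : ℝ, ∃ ε : ℝ, 0 < ε ∧ ∀ (ν T : ℝ), 0 < ν → 0 < T →
    ∀ (u : ℝ → E3 → E3) (p : ℝ → E3 → ℝ),
    IsClassicalNSSolutionOn (Ico 0 T) ν 0 u p → IsLerayHopfOn T ν 0 (u 0) u →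
    HasRapidSpatialDecay (u 0) → IsTypeIBlowupWith M ν u T →
    (∃ Λ : ℝ → ℝ, IsSubcriticalLevel T Λ ∧ HasLaplacianDefectAt T Λ ν ε u) →
    HasSmoothExtensionPast ν 0 u T

/-- **Criterion row F1vgq** (Type I(`M`) + ε(M)-UNIFORM-VORTICITY TOP ⇒ extension).  PROVED. -/
def Row_F1vgq : Prop :=
  ∀ M : ℝ, ∃ ε : ℝ, 0 < ε ∧ ∀ (ν T : ℝ), 0 < ν → 0 < T →
    ∀ (u : ℝ → E3 → E3) (p : ℝ → E3 → ℝ),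
    IsClassicalNSSolutionOn (Ico 0 T) ν 0 u p → IsLerayHopfOn T ν 0 (u 0) u →
    HasRapidSpatialDecay (u 0) → IsTypeIBlowupWith M ν u T →
    (∃ Λ : ℝ → ℝ, IsSubcriticalLevel T Λ ∧ HasVorticityGradientDefectAt T Λ ν ε u) →
    HasSmoothExtensionPast ν 0 u T

/-- **Criterion row F1afq** (Type I(`M`) + ε(M)-AFFINE TOP ⇒ extension).  PROVED. -/
def Row_F1afq : Prop :=
  ∀ M : ℝ, ∃ ε : ℝ, 0 < ε ∧ ∀ (ν T : ℝ), 0 < ν → 0 < T →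
    ∀ (u : ℝ → E3 → E3) (p : ℝ → E3 → ℝ),
    IsClassicalNSSolutionOn (Ico 0 T) ν 0 u p → IsLerayHopfOn T ν 0 (u 0) u →
    HasRapidSpatialDecay (u 0) → IsTypeIBlowupWith M ν u T →
    (∃ Λ : ℝ → ℝ, IsSubcriticalLevel T Λ ∧ HasHessianDefectAt T Λ ν ε u) →
    HasSmoothExtensionPast ν 0 u T

/-- **Criterion row F1vf** (`o`-form, the exact frame of `Row_F1` plus ONE hypothesis: an `o`-INVISCID TOP —
some subcritical level on whose top `√ν (T − t)^{3/2} ‖Δu‖ → 0`, i.e. the defect holds for EVERY `ε > 0`).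
PROVED (`rowF1vf_holds`). -/
def Row_F1vf : Prop :=
  ∀ (ν T : ℝ), 0 < ν → 0 < T → ∀ (u : ℝ → E3 → E3) (p : ℝ → E3 → ℝ),
    IsClassicalNSSolutionOn (Ico 0 T) ν 0 u p → IsLerayHopfOn T ν 0 (u 0) u →
    HasRapidSpatialDecay (u 0) → IsTypeIBlowup u T →
    (∃ Λ : ℝ → ℝ, IsSubcriticalLevel T Λ ∧ ∀ ε : ℝ, 0 < ε → HasLaplacianDefectAt T Λ ν ε u) →
    HasSmoothExtensionPast ν 0 u T

/-- **Criterion row F1vg** (`o`-UNIFORM-VORTICITY TOP: `√ν (T − t)^{3/2} ‖∇ω‖ → 0` on the top).  PROVED. -/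
def Row_F1vg : Prop :=
  ∀ (ν T : ℝ), 0 < ν → 0 < T → ∀ (u : ℝ → E3 → E3) (p : ℝ → E3 → ℝ),
    IsClassicalNSSolutionOn (Ico 0 T) ν 0 u p → IsLerayHopfOn T ν 0 (u 0) u →
    HasRapidSpatialDecay (u 0) → IsTypeIBlowup u T →
    (∃ Λ : ℝ → ℝ, IsSubcriticalLevel T Λ ∧ ∀ ε : ℝ, 0 < ε → HasVorticityGradientDefectAt T Λ ν ε u) →
    HasSmoothExtensionPast ν 0 u T

/-- **Criterion row F1af** (`o`-AFFINE TOP: `√ν (T − t)^{3/2} ‖∇²u‖ → 0` on the top).  PROVED. -/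
def Row_F1af : Prop :=
  ∀ (ν T : ℝ), 0 < ν → 0 < T → ∀ (u : ℝ → E3 → E3) (p : ℝ → E3 → ℝ),
    IsClassicalNSSolutionOn (Ico 0 T) ν 0 u p → IsLerayHopfOn T ν 0 (u 0) u →
    HasRapidSpatialDecay (u 0) → IsTypeIBlowup u T →
    (∃ Λ : ℝ → ℝ, IsSubcriticalLevel T Λ ∧ ∀ ε : ℝ, 0 < ε → HasHessianDefectAt T Λ ν ε u) →
    HasSmoothExtensionPast ν 0 u T

/-- **Ancient row (exact, one harmonic slice)**: `W ∈ 𝒦_C`, `Δ W(s, ·) ≡ 0` for one `s < 0` ⇒ `W ≡ 0`.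
PROVED (`liouville_harmonicSlice_holds`). -/
def Liouville_harmonicSlice : Prop :=
  ∀ (C : ℝ) (W : ℝ → E3 → E3), IsTypeIAncientMild C W → ∀ s < (0 : ℝ), (∀ y : E3, (Δ (W s)) y = 0) →
    ∀ t < (0 : ℝ), ∀ x : E3, W t x = 0

/-- **Ancient row (ε-Liouville, almost-harmonic)**: ∀ M ∃ ε(M) > 0: `(−s)^{3/2} ‖Δ W‖ ≤ ε` on the open past
⇒ `W ≡ 0`.  PROVED (`liouville_vfq_holds`). -/
def Liouville_vfq : Prop :=
  ∀ M : ℝ, ∃ ε : ℝ, 0 < ε ∧ ∀ W : ℝ → E3 → E3, IsTypeIAncientMild M W →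
    (∀ s < (0 : ℝ), ∀ y : E3, (-s) * Real.sqrt (-s) * ‖(Δ (W s)) y‖ ≤ ε) → ∀ s < (0 : ℝ), ∀ y : E3, W s y = 0

/-- **Ancient row (ε-Liouville, almost-uniform vorticity)**.  PROVED (`liouville_vgq_holds`). -/
def Liouville_vgq : Prop :=
  ∀ M : ℝ, ∃ ε : ℝ, 0 < ε ∧ ∀ W : ℝ → E3 → E3, IsTypeIAncientMild M W →
    (∀ s < (0 : ℝ), ∀ y : E3, (-s) * Real.sqrt (-s) * ‖fderiv ℝ (curl (W s)) y‖ ≤ ε) →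
    ∀ s < (0 : ℝ), ∀ y : E3, W s y = 0

/-- **Ancient row (ε-Liouville, almost-affine velocity)**.  PROVED (`liouville_afq_holds`). -/
def Liouville_afq : Prop :=
  ∀ M : ℝ, ∃ ε : ℝ, 0 < ε ∧ ∀ W : ℝ → E3 → E3, IsTypeIAncientMild M W →
    (∀ s < (0 : ℝ), ∀ y : E3, (-s) * Real.sqrt (-s) * ‖fderiv ℝ (fderiv ℝ (W s)) y‖ ≤ ε) →
    ∀ s < (0 : ℝ), ∀ y : E3, W s y = 0

/-- **VISCOUS TOP** (structural floor, maximal frame): for every `M` one `ε(M) > 0` such that a maximal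
Type-I(`M`) Clay blow-up has, on the top of EVERY subcritical level, none of the three second-order ε-defects:
the fast fluid keeps feeling a viscous force `≥ ε √ν (T − t)^{-3/2}`, a vorticity gradient and a velocity
Hessian `≥ ε ν^{-1/2} (T − t)^{-3/2}`, infinitely often as `t ↑ T`.  PROVED (`viscousTop_holds`). -/
def ViscousTop : Prop :=
  ∀ M : ℝ, ∃ ε : ℝ, 0 < ε ∧ ∀ (ν T : ℝ), 0 < ν → 0 < T →
    ∀ (u : ℝ → E3 → E3) (p : ℝ → E3 → ℝ),
    IsMaximalSmoothSolution ν 0 u p T → IsLerayHopfOn T ν 0 (u 0) u →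
    HasRapidSpatialDecay (u 0) → IsTypeIBlowupWith M ν u T →
    ∀ Λ : ℝ → ℝ, IsSubcriticalLevel T Λ →
      ¬ HasLaplacianDefectAt T Λ ν ε u ∧ ¬ HasVorticityGradientDefectAt T Λ ν ε u ∧
        ¬ HasHessianDefectAt T Λ ν ε u

/-- **Residual** (maximal frame): for every `M` and every `ε > 0`, every maximal Type-I(`M`) Clay blow-up has an
ε-inviscid top at some subcritical level.  DECLARED ≡ row F1 (`laplacianDefectSlack_iff_rowF1`); no movement on
`Row_F1` is claimed. -/
@[conjecture] def LaplacianDefectSlack : Prop :=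
  ∀ (M ε : ℝ), 0 < ε → ∀ (ν T : ℝ), 0 < ν → 0 < T →
    ∀ (u : ℝ → E3 → E3) (p : ℝ → E3 → ℝ),
    IsMaximalSmoothSolution ν 0 u p T → IsLerayHopfOn T ν 0 (u 0) u →
    HasRapidSpatialDecay (u 0) → IsTypeIBlowupWith M ν u T →
    ∃ Λ : ℝ → ℝ, IsSubcriticalLevel T Λ ∧ HasLaplacianDefectAt T Λ ν ε u

/-- **The split**: criterion + residual ⇒ row F1 (by cases on extendability; `M = C/√ν`). -/
theorem rowF1_of (hD : Row_F1vfq) (hR : LaplacianDefectSlack) : ScenarioCensus.Row_F1 := by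
  unfold ScenarioCensus.Row_F1
  intro ν T hν hT u p hsol hLH hdec hTI
  obtain ⟨M, hM⟩ := exists_isTypeIBlowupWith hν hTI
  obtain ⟨ε, hε, hrow⟩ := hD M
  by_contra hext
  exact hext (hrow ν T hν hT u p hsol hLH hdec hM (hR M ε hε ν T hν hT u p ⟨hsol, hext⟩ hLH hdec hM))

/-- The residual is a consequence of the row (vacuously: under `Row_F1` no maximal solution is Type I). -/
theorem laplacianDefectSlack_of_rowF1 (h : ScenarioCensus.Row_F1) : LaplacianDefectSlack :=
  fun _ _ _ ν T hν hT u p hmax hLH hdec hTI =>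
    (hmax.2 (h ν T hν hT u p hmax.1 hLH hdec hTI.isTypeIBlowup)).elim

/-- The `o`-rows follow from the `M`-quantitative rows. -/
theorem rowF1vf_of_rowF1vfq (h : Row_F1vfq) : Row_F1vf := by
  intro ν T hν hT u p hsol hLH hdec hTI ⟨Λ, hΛ, hall⟩
  obtain ⟨M, hM⟩ := exists_isTypeIBlowupWith hν hTI
  obtain ⟨ε, hε, hrow⟩ := h M
  exact hrow ν T hν hT u p hsol hLH hdec hM ⟨Λ, hΛ, hall ε hε⟩

/-- The `o`-form F1vg follows from the `M`-quantitative form F1vgq. -/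
theorem rowF1vg_of_rowF1vgq (h : Row_F1vgq) : Row_F1vg := by
  intro ν T hν hT u p hsol hLH hdec hTI ⟨Λ, hΛ, hall⟩
  obtain ⟨M, hM⟩ := exists_isTypeIBlowupWith hν hTI
  obtain ⟨ε, hε, hrow⟩ := h M
  exact hrow ν T hν hT u p hsol hLH hdec hM ⟨Λ, hΛ, hall ε hε⟩

/-- The `o`-form F1af follows from the `M`-quantitative form F1afq. -/
theorem rowF1af_of_rowF1afq (h : Row_F1afq) : Row_F1af := by
  intro ν T hν hT u p hsol hLH hdec hTI ⟨Λ, hΛ, hall⟩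
  obtain ⟨M, hM⟩ := exists_isTypeIBlowupWith hν hTI
  obtain ⟨ε, hε, hrow⟩ := h M
  exact hrow ν T hν hT u p hsol hLH hdec hM ⟨Λ, hΛ, hall ε hε⟩

/-- An ε-affine top is a 3ε-inviscid top (`‖Δu‖ ≤ 3‖∇²u‖`): lattice edge. -/
theorem HasHessianDefectAt.hasLaplacianDefectAt {T ν ε : ℝ} {Λ : ℝ → ℝ} {u : ℝ → E3 → E3}
    (h : HasHessianDefectAt T Λ ν ε u) : HasLaplacianDefectAt T Λ ν (3 * ε) u :=
  Filter.Eventually.mono h fun t ht x hx => by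
    calc clock₂ ν T t * ‖(Δ (u t)) x‖ ≤ clock₂ ν T t * (3 * ‖fderiv ℝ (fderiv ℝ (u t)) x‖) := by
          rw [laplacian_eq_lapOf]
          exact mul_le_mul_of_nonneg_left (norm_lapOf_le _) (clock₂_nonneg ν T t)
      _ = 3 * (clock₂ ν T t * ‖fderiv ℝ (fderiv ℝ (u t)) x‖) := by ring
      _ ≤ 3 * ε := by linarith [ht x hx]

/-- Row F1afq from row F1vfq (lattice check, `ε ↦ ε/3`). -/
theorem rowF1afq_of_rowF1vfq (h : Row_F1vfq) : Row_F1afq := by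
  intro M
  obtain ⟨ε, hε, hrow⟩ := h M
  refine ⟨ε / 3, by positivity, fun ν T hν hT u p hsol hLH hdec hTI ⟨Λ, hΛ, hH⟩ => ?_⟩
  have h3 := hH.hasLaplacianDefectAt
  rw [show 3 * (ε / 3) = ε by ring] at h3
  exact hrow ν T hν hT u p hsol hLH hdec hTI ⟨Λ, hΛ, h3⟩

/-- The Liouville rows hold (in kernel). -/
theorem liouville_harmonicSlice_holds : Liouville_harmonicSlice :=
  fun _ _ hW _ hs hΔ => eq_zero_of_laplacian_slice_eq_zero hW hs hΔ

/-- The ε-Liouville row (almost-harmonic) holds. -/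
theorem liouville_vfq_holds : Liouville_vfq := exists_eps_liouville_laplacian

/-- The ε-Liouville row (almost-uniform vorticity) holds. -/
theorem liouville_vgq_holds : Liouville_vgq := exists_eps_liouville_vorticityGradient

/-- The ε-Liouville row (almost-affine velocity) holds. -/
theorem liouville_afq_holds : Liouville_afq := exists_eps_liouville_hessian

/-- Backward singularity at `(T, x₀)` from the failure of local boundedness. -/
theorem sing_of_not_bounded {T : ℝ} {u : ℝ → E3 → E3} {x₀ : E3}
    (hno : ¬ ∃ r : ℝ, 0 < r ∧
      eLpNorm (uncurry u) ∞ (volume.restrict (parabolicCylinder r ((T : ℝ), x₀))) < ⊤) :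
    ∀ r : ℝ, 0 < r → eLpNorm (uncurry u) ∞ (volume.restrict (parabolicCylinder r ((T : ℝ), x₀))) = ∞ := by
  intro r hr
  by_contra h
  exact hno ⟨r, hr, lt_top_iff_ne_top.2 h⟩

/-- Slices of a classical solution are `C²` near the blow-up time (for the vorticity-gradient read-out). -/
theorem eventually_contDiff_slice {ν T : ℝ} (hT : 0 < T) {u : ℝ → E3 → E3} {p : ℝ → E3 → ℝ}
    (hsol : IsClassicalNSSolutionOn (Ico 0 T) ν 0 u p) :
    ∀ᶠ t in 𝓝[<] T, ContDiff ℝ 2 (u t) := by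
  filter_upwards [Ioo_mem_nhdsLT hT] with t ht
  exact (hsol.smooth_velocity.contDiff_slice (Ioo_subset_Ico_self ht)).of_le (by norm_cast)

/-- **Criterion row F1vfq is EXCLUDED** (in kernel): Type I(`M`) + ε(M)-inviscid top ⇒ extension. -/
theorem rowF1vfq_holds : Row_F1vfq := by
  intro M
  obtain ⟨ε, hε, hLiou⟩ := exists_eps_liouville_laplacian M
  refine ⟨ε, hε, fun ν T hν hT u p hsol hLH hdec hTI htop => ?_⟩
  obtain ⟨Λ, hΛ, hdef⟩ := htop
  apply hasSmoothExtensionPast_of_forall_exists_parabolicCylinder hν hT hsol hLH hdec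
  intro x₀
  by_contra hno
  obtain ⟨α, β, R, c, W, hα, hβ, hR, hαR, hαν, hcpos, hclim, hW, hpt, -, hhess, t, ht, y, hne⟩ :=
    exists_singularZoom_package₂ hν hT hsol hLH hdec hTI x₀ (sing_of_not_bounded hno)
  have hH : ∀ᶠ t' in 𝓝[<] T, ∀ x : E3, Λ t' < ‖u t' x‖ →
      clock₂ ν T t' * ‖lapOf (fderiv ℝ (fderiv ℝ (u t')) x)‖ ≤ ε :=
    Filter.Eventually.mono hdef fun t' ht' x hx => by rw [← laplacian_eq_lapOf]; exact ht' x hx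
  have hall := hessian_transfer_everywhere hW hα hβ hαR hαν hcpos hclim hpt hhess
    (Rd := fun H => ‖lapOf H‖) continuous_lapOf.norm
    (fun a ha H => by show ‖lapOf (a • H)‖ = a * ‖lapOf H‖
                      rw [lapOf_smul, norm_smul, Real.norm_eq_abs, abs_of_nonneg ha])
    (by show ‖lapOf 0‖ = 0; simp [lapOf]) hε.le hΛ hH
  exact hne (hLiou W hW (fun s hs y' => by rw [laplacian_eq_lapOf]; exact hall s hs y') t ht y)

/-- **Criterion row F1vgq is EXCLUDED** (in kernel): Type I(`M`) + ε(M)-uniform-vorticity top ⇒ extension. -/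
theorem rowF1vgq_holds : Row_F1vgq := by
  intro M
  obtain ⟨ε, hε, hLiou⟩ := exists_eps_liouville_vorticityGradient M
  refine ⟨ε, hε, fun ν T hν hT u p hsol hLH hdec hTI htop => ?_⟩
  obtain ⟨Λ, hΛ, hdef⟩ := htop
  apply hasSmoothExtensionPast_of_forall_exists_parabolicCylinder hν hT hsol hLH hdec
  intro x₀
  by_contra hno
  obtain ⟨α, β, R, c, W, hα, hβ, hR, hαR, hαν, hcpos, hclim, hW, hpt, -, hhess, t, ht, y, hne⟩ :=
    exists_singularZoom_package₂ hν hT hsol hLH hdec hTI x₀ (sing_of_not_bounded hno)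
  have hH : ∀ᶠ t' in 𝓝[<] T, ∀ x : E3, Λ t' < ‖u t' x‖ →
      clock₂ ν T t' * ‖vortGradOf (fderiv ℝ (fderiv ℝ (u t')) x)‖ ≤ ε := by
    filter_upwards [hdef, eventually_contDiff_slice hT hsol] with t' ht' h2 x hx
    rw [← fderiv_curl_eq_vortGradOf h2 le_rfl]
    exact ht' x hx
  have hall := hessian_transfer_everywhere hW hα hβ hαR hαν hcpos hclim hpt hhess
    (Rd := fun H => ‖vortGradOf H‖) continuous_vortGradOf.norm
    (fun a ha H => by show ‖vortGradOf (a • H)‖ = a * ‖vortGradOf H‖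
                      rw [vortGradOf_smul, norm_smul, Real.norm_eq_abs, abs_of_nonneg ha])
    (by show ‖vortGradOf 0‖ = 0; simp [vortGradOf]) hε.le hΛ hH
  refine hne (hLiou W hW (fun s hs y' => ?_) t ht y)
  rw [fderiv_curl_eq_vortGradOf (hW.contDiff_slice hs) (by norm_cast)]
  exact hall s hs y'

/-- **Criterion row F1afq is EXCLUDED** (in kernel): Type I(`M`) + ε(M)-affine top ⇒ extension (lattice
corollary of F1vfq: an ε-affine top is a 3ε-inviscid top). -/
theorem rowF1afq_holds : Row_F1afq := rowF1afq_of_rowF1vfq rowF1vfq_holds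

/-- The `o`-rows hold (in kernel). -/
theorem rowF1vf_holds : Row_F1vf := rowF1vf_of_rowF1vfq rowF1vfq_holds

/-- **Row F1vg holds.** -/
theorem rowF1vg_holds : Row_F1vg := rowF1vg_of_rowF1vgq rowF1vgq_holds

/-- **Row F1af holds.** -/
theorem rowF1af_holds : Row_F1af := rowF1af_of_rowF1afq rowF1afq_holds

/-- **The floor VISCOUS TOP holds** (one `ε(M)` for all three defects: the minimum). -/
theorem viscousTop_holds : ViscousTop := by
  intro M
  obtain ⟨ε₁, hε₁, h₁⟩ := rowF1vfq_holds M
  obtain ⟨ε₂, hε₂, h₂⟩ := rowF1vgq_holds M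
  obtain ⟨ε₃, hε₃, h₃⟩ := rowF1afq_holds M
  refine ⟨min ε₁ (min ε₂ ε₃), lt_min hε₁ (lt_min hε₂ hε₃),
    fun ν T hν hT u p hmax hLH hdec hTI Λ hΛ => ⟨fun h => ?_, fun h => ?_, fun h => ?_⟩⟩
  · exact hmax.2 (h₁ ν T hν hT u p hmax.1 hLH hdec hTI ⟨Λ, hΛ, h.mono (min_le_left _ _)⟩)
  · exact hmax.2 (h₂ ν T hν hT u p hmax.1 hLH hdec hTI
      ⟨Λ, hΛ, h.mono ((min_le_right _ _).trans (min_le_left _ _))⟩)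
  · exact hmax.2 (h₃ ν T hν hT u p hmax.1 hLH hdec hTI
      ⟨Λ, hΛ, h.mono ((min_le_right _ _).trans (min_le_right _ _))⟩)

/-- **VISCOUS TOP, unfolded** (display, constant levels): ∀ M ∃ ε(M) > 0: in the maximal Type-I(`M`) Clay
frame, for EVERY level `Λ` and every `t₁ < T` some `t ∈ (t₁, T)` has a `Λ`-fast point with
`√ν (T − t)^{3/2} ‖Δu(t, x)‖ > ε` — the viscous force on the fast fluid is `> ε √ν (T − t)^{-3/2}`,
an `ε/M`-fraction of the inertial scale, arbitrarily close to `T`: Type-I blow-up is never asymptotically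
inviscid on its top. -/
theorem viscousTop_unfolded : ∀ M : ℝ, ∃ ε : ℝ, 0 < ε ∧ ∀ (ν T : ℝ), 0 < ν → 0 < T →
    ∀ (u : ℝ → E3 → E3) (p : ℝ → E3 → ℝ),
    IsMaximalSmoothSolution ν 0 u p T → IsLerayHopfOn T ν 0 (u 0) u →
    HasRapidSpatialDecay (u 0) → IsTypeIBlowupWith M ν u T →
    ∀ Λ : ℝ, ∀ t₁ : ℝ, t₁ < T →
      ∃ t ∈ Ioo t₁ T, ∃ x : E3, Λ < ‖u t x‖ ∧
        ε < Real.sqrt ν * ((T - t) * Real.sqrt (T - t)) * ‖(Δ (u t)) x‖ := by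
  intro M
  obtain ⟨ε, hε, hfl⟩ := viscousTop_holds M
  refine ⟨ε, hε, fun ν T hν hT u p hmax hLH hdec hTI Λ t₁ ht₁ => ?_⟩
  by_contra hno
  push Not at hno
  refine (hfl ν T hν hT u p hmax hLH hdec hTI (fun _ => Λ) (isSubcriticalLevel_const T Λ)).1 ?_
  exact eventually_of_mem (Ioo_mem_nhdsLT ht₁) fun t ht x hx => hno t ht x hx

/-- **UNIFORM VORTICITY GRADIENT ON THE TOP, unfolded** (display). -/
theorem vorticityGradientTop_unfolded : ∀ M : ℝ, ∃ ε : ℝ, 0 < ε ∧ ∀ (ν T : ℝ), 0 < ν → 0 < T →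
    ∀ (u : ℝ → E3 → E3) (p : ℝ → E3 → ℝ),
    IsMaximalSmoothSolution ν 0 u p T → IsLerayHopfOn T ν 0 (u 0) u →
    HasRapidSpatialDecay (u 0) → IsTypeIBlowupWith M ν u T →
    ∀ Λ : ℝ, ∀ t₁ : ℝ, t₁ < T →
      ∃ t ∈ Ioo t₁ T, ∃ x : E3, Λ < ‖u t x‖ ∧
        ε < Real.sqrt ν * ((T - t) * Real.sqrt (T - t)) * ‖fderiv ℝ (curl (u t)) x‖ := by
  intro M
  obtain ⟨ε, hε, hfl⟩ := viscousTop_holds M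
  refine ⟨ε, hε, fun ν T hν hT u p hmax hLH hdec hTI Λ t₁ ht₁ => ?_⟩
  by_contra hno
  push Not at hno
  refine (hfl ν T hν hT u p hmax hLH hdec hTI (fun _ => Λ) (isSubcriticalLevel_const T Λ)).2.1 ?_
  exact eventually_of_mem (Ioo_mem_nhdsLT ht₁) fun t ht x hx => hno t ht x hx

/-- The residual is EXACTLY row F1 (declared; no movement on `Row_F1` is claimed). -/
theorem laplacianDefectSlack_iff_rowF1 : LaplacianDefectSlack ↔ ScenarioCensus.Row_F1 :=
  ⟨rowF1_of rowF1vfq_holds, laplacianDefectSlack_of_rowF1⟩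

/-- Deciding direction used by the split. -/
theorem rowF1_of_laplacianDefectSlack : LaplacianDefectSlack → ScenarioCensus.Row_F1 :=
  rowF1_of rowF1vfq_holds

end Summit.NavierStokesRegularity.NavierStokesRegularity.Theorems.ScenarioCensus.InviscidTop

namespace Summit.NavierStokesRegularity.NavierStokesRegularity.Theorems.ScenarioCensus

/-! ## Census KEYS (ns `…Theorems.ScenarioCensus`): the SECOND-ORDER-TOP family of row F1 — TREE-decided members -/

/-- **Cell F1vfq** (row F1 frame VERBATIM + Type I(`M`) + ε(M)-inviscid top `√ν (T−t)^{3/2}‖Δu‖ ≤ ε(M)` on the top of one subcritical level ⇒ smooth extension past `T`): `:= InviscidTop.Row_F1vfq`. DECIDED. -/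
def Row_F1vfq : Prop := InviscidTop.Row_F1vfq
/-- F1vfq is EXCLUDED (decided in the tree): `InviscidTop.rowF1vfq_holds`. -/
theorem row_F1vfq_excluded : Row_F1vfq := InviscidTop.rowF1vfq_holds

/-- **Cell F1vgq** (ε(M)-uniform-vorticity top `√ν (T−t)^{3/2}‖∇ω‖ ≤ ε(M)`): `:= InviscidTop.Row_F1vgq`. DECIDED. -/
def Row_F1vgq : Prop := InviscidTop.Row_F1vgq
/-- F1vgq is EXCLUDED (decided in the tree): `InviscidTop.rowF1vgq_holds`. -/
theorem row_F1vgq_excluded : Row_F1vgq := InviscidTop.rowF1vgq_holds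

/-- **Cell F1afq** (⊆ F1vfq; ε(M)-affine top `√ν (T−t)^{3/2}‖∇²u‖ ≤ ε(M)`): `:= InviscidTop.Row_F1afq`. DECIDED. -/
def Row_F1afq : Prop := InviscidTop.Row_F1afq
/-- F1afq is EXCLUDED (decided in the tree): `InviscidTop.rowF1afq_holds`. -/
theorem row_F1afq_excluded : Row_F1afq := InviscidTop.rowF1afq_holds

/-- **Cell F1vf** (o-form of F1vfq: `√ν (T−t)^{3/2}‖Δu‖ → 0` on the top of one subcritical level): `:= InviscidTop.Row_F1vf`. DECIDED. -/
def Row_F1vf : Prop := InviscidTop.Row_F1vf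
/-- F1vf is EXCLUDED (decided in the tree): `InviscidTop.rowF1vf_holds`. -/
theorem row_F1vf_excluded : Row_F1vf := InviscidTop.rowF1vf_holds

/-- **Cell F1vg** (o-form of F1vgq): `:= InviscidTop.Row_F1vg`. DECIDED. -/
def Row_F1vg : Prop := InviscidTop.Row_F1vg
/-- F1vg is EXCLUDED (decided in the tree): `InviscidTop.rowF1vg_holds`. -/
theorem row_F1vg_excluded : Row_F1vg := InviscidTop.rowF1vg_holds

/-- **Cell F1af** (o-form of F1afq): `:= InviscidTop.Row_F1af`. DECIDED. -/
def Row_F1af : Prop := InviscidTop.Row_F1af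
/-- F1af is EXCLUDED (decided in the tree): `InviscidTop.rowF1af_holds`. -/
theorem row_F1af_excluded : Row_F1af := InviscidTop.rowF1af_holds

/-- **Floor VISCOUS TOP** at the level of the census keys: `InviscidTop.viscousTop_holds`. -/
theorem row_F1_viscousTop : InviscidTop.ViscousTop := InviscidTop.viscousTop_holds

end Summit.NavierStokesRegularity.NavierStokesRegularity.Theorems.ScenarioCensus

end
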